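import Summits.MatrixMultiplication.OmegaCensus.STPPKill223332332Z46AP4

/-!
# ω-census (abelian STPP census): `{(2,2,3),(3,3,2),(3,3,2)}` in `ℤ/46ℤ` — reduction to the single remaining branch «one `C_j` is a `K`-coset» (kernel)

HONEST FRAMING (pub-omega census; verbatim): lottery ticket; floor = certified bounds/negative ranges.
Census STRUCTURE (seat pub-omega-stpp-2 gen 32, 2026-08-30), family (b2); HOME `pub-omega-stpp-2-g32/CASEMAP.md` §6.  Combining `blockA/B/C_structure`,
`not_coset_coset`, `coset_C_of_coset_A/B` and `no_allAP_223_332_332` (Branch I empty): **an STPP family of the pattern in `ℤ/46ℤ` exists only if BRANCH II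
occurs** — for some ordering `{i, j} = {1, 2}`: `C_j = {c, c + 23}`, while `C_i`, `A_j`, `B_j` are of progression type (with their partner unions) and `A_i`,
`B_i` satisfy the `blockA/B_structure` dichotomies (`reduce_to_branchII`).  The successor's Branch-II file therefore closes order `46`.  Nothing here is
progress on `ω`.

References: H. Cohn, R. Kleinberg, B. Szegedy, C. Umans, FOCS 2005 (arXiv:math/0511460), Def. 5.1; Kemperman 1960 / Kneser 1953 (through the structure files).
-/

open Finset
open scoped Pointwise

namespace Summit.MatrixMultiplication.OmegaCensus.Z46

open Literature.Computability.AlgebraicComplexity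
open Literature.Combinatorics.Additive
open Summit.MatrixMultiplication.OmegaCensus.STPPKneser
open Summit.MatrixMultiplication.OmegaCensus.CubeNB

variable {A B C : Fin 3 → Finset (ZMod 46)}

/-- A two-element progression of step `δ` with `2δ ≠ 0` is not a `K`-coset. [folklore] -/
theorem not_coset_of_isAP {S : Finset (ZMod 46)} {δ c : ZMod 46} (hδ : 2 • δ ≠ 0) (hS : #S = 2) (hap : IsAP S δ) (hc : S = {c, c + 23}) : False := by
  obtain ⟨c', hc'⟩ := hap
  rw [hS] at hc'
  have h0 : c' ∈ S := by rw [hc']; exact mem_apFinset.2 ⟨0, by norm_num, by rw [zero_nsmul, add_zero]⟩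
  have h1 : c' + δ ∈ S := by rw [hc']; exact mem_apFinset.2 ⟨1, by norm_num, by rw [one_nsmul]⟩
  have hδ0 : δ ≠ 0 := by rintro rfl; exact hδ (by rw [nsmul_zero])
  rw [hc, Finset.mem_insert, Finset.mem_singleton] at h0 h1
  have h23 : δ = 23 ∨ δ = -23 := by
    rcases h0 with rfl | rfl <;> rcases h1 with h1 | h1
    · exact absurd (by simpa using h1 : δ = 0) hδ0
    · exact Or.inl (by have := h1; exact add_left_cancel this)
    · right
      have : c + 23 + δ + 23 = c + 23 := by rw [h1]
      have h2 : δ + 23 = 0 := by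
        have := congrArg (fun x => x - (c + 23)) this
        simpa [add_assoc, add_sub_cancel_left] using this
      exact eq_neg_of_add_eq_zero_left h2
    · exact absurd (by simpa using h1 : δ = 0) hδ0
  rcases h23 with rfl | rfl <;> exact hδ (by decide)

/-- **Reduction to Branch II.**  See the module docstring; `hII` is what the successor's Branch-II file must supply. [cite: CohnKleinbergSzegedyUmans2005, Def. 5.1]
[cite: Kemperman1960, Thm 2.1] [cite: Kneser1953] -/
theorem reduce_to_branchII (hS : IsSTPP A B C) (hA : ∀ i, #(A i) = ![2, 3, 3] i) (hB : ∀ i, #(B i) = ![2, 3, 3] i)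
    (hC : ∀ i, #(C i) = ![3, 2, 2] i)
    (hII : ∀ i j : Fin 3, i ≠ 0 → j ≠ 0 → i ≠ j → (∃ c : ZMod 46, C j = {c, c + 23}) →
      (∃ δ : ZMod 46, 2 • δ ≠ 0 ∧ IsAP (C i) δ ∧ IsAP (DU A B (univ.erase i)) δ) →
      (∃ d : ZMod 46, 2 • d ≠ 0 ∧ IsAP (A j) d ∧ IsAP (DU B C (univ.erase j)) d) →
      (∃ e : ZMod 46, 2 • e ≠ 0 ∧ IsAP (B j) e ∧ IsAP (DU A C (univ.erase j)) e) →
      ((∃ d : ZMod 46, 2 • d ≠ 0 ∧ IsAP (A i) d ∧ IsAP (DU B C (univ.erase i)) d) ∨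
        ((23 : ZMod 46) +ᵥ DU B C (univ.erase i) = DU B C (univ.erase i) ∧ ∃ a ∈ A i, a + 23 ∈ A i)) →
      ((∃ e : ZMod 46, 2 • e ≠ 0 ∧ IsAP (B i) e ∧ IsAP (DU A C (univ.erase i)) e) ∨
        ((23 : ZMod 46) +ᵥ DU A C (univ.erase i) = DU A C (univ.erase i) ∧ ∃ b ∈ B i, b + 23 ∈ B i)) → False) : False := by
  have h10 : (1 : Fin 3) ≠ 0 := by decide
  have h20 : (2 : Fin 3) ≠ 0 := by decide
  have h12 : (1 : Fin 3) ≠ 2 := by decide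
  have hC12 : #(C 1) = 2 := by rw [hC]; rfl
  have hC22 : #(C 2) = 2 := by rw [hC]; rfl
  have sA1 := blockA_structure hS hA hB hC 1 h10
  have sA2 := blockA_structure hS hA hB hC 2 h20
  have sB1 := blockB_structure hS hA hB hC 1 h10
  have sB2 := blockB_structure hS hA hB hC 2 h20
  -- a `K`-coset in `A_i`/`B_i` forces `C_j` to be a coset; so when `C_j` is of progression type, `A_i`, `B_i` are of progression type
  have apA : ∀ {i j : Fin 3}, j ≠ 0 → i ≠ j → ∀ {δ : ZMod 46}, 2 • δ ≠ 0 → IsAP (C j) δ → #(C j) = 2 →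
      ((∃ d : ZMod 46, 2 • d ≠ 0 ∧ IsAP (A i) d ∧ IsAP (DU B C (univ.erase i)) d) ∨
        ((23 : ZMod 46) +ᵥ DU B C (univ.erase i) = DU B C (univ.erase i) ∧ ∃ a ∈ A i, a + 23 ∈ A i)) →
      ∃ d : ZMod 46, 2 • d ≠ 0 ∧ IsAP (A i) d ∧ IsAP (DU B C (univ.erase i)) d := by
    intro i j hj hij δ hδ hCj hcard h
    rcases h with h | ⟨-, hK⟩
    · exact h
    · obtain ⟨c, hc⟩ := coset_C_of_coset_A hS hA hB hC hj hij hK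
      exact (not_coset_of_isAP hδ hcard hCj hc).elim
  have apB : ∀ {i j : Fin 3}, j ≠ 0 → i ≠ j → ∀ {δ : ZMod 46}, 2 • δ ≠ 0 → IsAP (C j) δ → #(C j) = 2 →
      ((∃ e : ZMod 46, 2 • e ≠ 0 ∧ IsAP (B i) e ∧ IsAP (DU A C (univ.erase i)) e) ∨
        ((23 : ZMod 46) +ᵥ DU A C (univ.erase i) = DU A C (univ.erase i) ∧ ∃ b ∈ B i, b + 23 ∈ B i)) →
      ∃ e : ZMod 46, 2 • e ≠ 0 ∧ IsAP (B i) e ∧ IsAP (DU A C (univ.erase i)) e := by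
    intro i j hj hij δ hδ hCj hcard h
    rcases h with h | ⟨-, hK⟩
    · exact h
    · obtain ⟨c, hc⟩ := coset_C_of_coset_B hS hA hB hC hj hij hK
      exact (not_coset_of_isAP hδ hcard hCj hc).elim
  rcases blockC_structure hS hA hB hC 1 h10 with ⟨δ₁, hδ₁, hC1, hX1⟩ | ⟨c₁, hc₁⟩ <;>
    rcases blockC_structure hS hA hB hC 2 h20 with ⟨δ₂, hδ₂, hC2, hX2⟩ | ⟨c₂, hc₂⟩
  · -- Branch I
    obtain ⟨d₁, hd₁, hA1, hY1⟩ := apA h20 h12 hδ₂ hC2 hC22 sA1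
    obtain ⟨e₁, he₁, hB1, hZ1⟩ := apB h20 h12 hδ₂ hC2 hC22 sB1
    obtain ⟨d₂, hd₂, hA2, hY2⟩ := apA h10 h12.symm hδ₁ hC1 hC12 sA2
    obtain ⟨e₂, he₂, hB2, hZ2⟩ := apB h10 h12.symm hδ₁ hC1 hC12 sB2
    exact no_allAP_223_332_332 hS hA hB hC hd₁ hA1 hY1 he₁ hB1 hZ1 hd₂ hA2 hY2 he₂ hB2 hZ2 hδ₂ hC2 hX2
  · -- `C₂` coset: Branch II with `(i, j) = (1, 2)`
    exact hII 1 2 h10 h20 h12 ⟨c₂, hc₂⟩ ⟨δ₁, hδ₁, hC1, hX1⟩ (apA h10 h12.symm hδ₁ hC1 hC12 sA2) (apB h10 h12.symm hδ₁ hC1 hC12 sB2) sA1 sB1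
  · -- `C₁` coset: Branch II with `(i, j) = (2, 1)`
    exact hII 2 1 h20 h10 h12.symm ⟨c₁, hc₁⟩ ⟨δ₂, hδ₂, hC2, hX2⟩ (apA h20 h12 hδ₂ hC2 hC22 sA1) (apB h20 h12 hδ₂ hC2 hC22 sB1) sA2 sB2
  · exact not_coset_coset hS hA hB hC hc₁ hc₂

end Summit.MatrixMultiplication.OmegaCensus.Z46
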